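import Literature.NumberTheory.FaltingsSerre.ConjCertificate
import Literature.NumberTheory.FaltingsSerre.Paramodular349
import HarnessLib

/-!
# The core certificate: only the blocks a certificate file must ATTEST (`J = antiIdAlt4 ℤ₂`, `ℓ = 2`)

[BPPTVY] = A. Brumer, A. Pacetti, C. Poor, G. Tornaría, J. Voight, D. S. Yuen, *On the paramodularity of
typical abelian surfaces*, Algebra & Number Theory **13**:5 (2019) 1145–1195 [cite: BrumerEtAl2019].

The certificate schemas `Certificate S P J ν ρ₁ ρ₂` (`ParamodularCertificate.lean`) and
`ConjCertificate S P ν ρ₁ ρ₂` / `SurfaceConjCertificate N T ν ρA ρf` (`ConjCertificate.lean`) carry,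
besides the genuinely certificate-attested blocks, three fields that are NOT independent data but
CONSEQUENCES of the other binders of the instance template
(`paramodular_of_surfaceConjCertificate`, binders `hframe`, `hA`, `hρf`):
* `unramified₁ : ∀ v ∉ S, ρA.IsUnramifiedAt v` — for `ρA` an integral frame of `ρ_{A,2}` this is
  [BPPTVY, (4.1.3) p. 1163: "`ρ_{A,ℓ} : Gal_{ℚ,S} → GSp₄(ℤ_ℓ)` … unramified outside `ℓN`"], and in the
  tree it FOLLOWS from the good Euler factors `hA` (`AbelianVariety.HasGoodEulerFactorAt` records
  unramifiedness) via `integralForm_of_hasGoodEulerFactorAt` (`ParamodularBridge.lean`);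
* `unramified₂ : ∀ v ∉ S, ρf.IsUnramifiedAt v` — this is [BPPTVY, Thm 4.3.4 (iii) p. 1169:
  "`ρ_{f,ℓ}` is unramified outside `ℓN`"], a property of the CITED representation `ρ_{f,2}`
  (Taylor–Laumon–Weissauer–Schmidt–Mok; Arthur-dependent), i.e. an INPUT of the same standing as
  `hρf` = Thm 4.3.4 (iv), not something a certificate computes;
* `traces : ∀ σ ∈ frobeniusAt ℚ (placesOver T), tr ρA σ = tr ρf σ` — Step 5 of [BPPTVY, Alg 2.4.1
  p. 1156]; [§7.1 p. 1188: "to conclude we will show that `tr ρ_A(Frob_p) = tr ρ_f(Frob_p)` for all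
  `p ≤ 43`.  The former traces can be done by counting points, the latter traces were computed using
  the method in Example 6.6.1, and we check that they are equal"].  Given the Euler data the template
  ALREADY binds — `hA` : `L_p(A,T) = 1 − aA p T + bA p T² − …` [(4.1.5) p. 1164] and `hρf` :
  `det(X − ρf(Frob_v)) = X⁴Q_p(f,1/X)`, `Q_p(f,T) = 1 − af p T + bf p T² − …` [(4.2.18) p. 1168,
  Thm 4.3.4 (iv)] — the trace of an arithmetic Frobenius at `v ∣ p` is `aA p`, resp. `af p`
  (`tr M = −coeff_{n−1}(charpoly M)`, Mathlib `Matrix.trace_eq_neg_charpoly_coeff`), so Step 5 IS the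
  finite list of integer equalities `aA p = af p`, `p ∈ T` — the `trace_check` block of the cell's
  certificate JSON — provided every `p ∈ T` is a good odd prime (`p ∤ 2N`), which is how `T` is
  produced (Step 4 searches among good primes).

THIS FILE therefore types the **core certificate**
`CoreCertificate N T ν ρA ρf` = the five fields `similitude₁`, `similitude₂` [(4.1.3); Thm 4.3.4 (ii)],
`residual_conj` (Step 1 up to `ι(S₆)`-conjugacy, [§2.3 p. 1149; Alg 2.2.3]), `absIrreducible`
[Lemma 5.1.7 p. 1173, Lemma 5.2.1 p. 1174] and `complete` (Steps 2–4, [Alg 2.4.1 p. 1156; Thm 5.3.1 / 5.3.3 p. 1176]) —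
exactly the blocks `similitude`, `residual`, `classfield` + `group_theory` + `obstructing` of the
certificate JSON — and proves, kernel-checked and with no new cited fact:
* `isUnramifiedAt_of_hasGoodEulerFactors` — `unramified₁` from `hframe` + `hA`;
* `trace_eq_of_hasFrobCharpolyAt_lPolynomialOfSurface` — `tr ρ(Frob) = a` from a surface-shaped
  Frobenius polynomial (with `natDegree_lPolynomialOfSurface`, `coeff_reverse_lPolynomialOfSurface_three`);
* `CoreCertificate.toSurfaceConjCertificate` — core certificate + `hframe`, `hA`, `hρf_unr` (Thm
  4.3.4 (iii)), `hρf` (Thm 4.3.4 (iv)), `hT : ∀ p ∈ T, p.Prime ∧ p ∤ N ∧ p ≠ 2` and the trace table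
  `h5 : ∀ p ∈ T, aA p = af p` ⟹ `SurfaceConjCertificate N T ν ρA ρf`;
* `paramodular_of_coreCertificate` — THE INSTANCE TEMPLATE in core form: conclusion
  `IsParamodularAwayFrom A N f`, criterion discharged by `traceEq_of_faltingsSerre_symplectic_holds`;
* `CoreCertificate.ofSurfaceConjCertificate` — the forgetful direction (consistency);
* the worked instance `N = 349`: `Paramodular349.CoreCertificate349`, `checkPrimes349_good`
  (`T = {3,…,31,43}` consists of odd primes `≠ 349`, by `decide`), `paramodular_349_of_coreCertificate`.
Net effect for the pipeline: two blocks (`unramified`, `trace_check`) leave the hash-attested part of a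
certificate; `trace_check` becomes the explicit hypothesis `h5` on the Euler data `aA`, `af`.

## References
* [BPPTVY] (4.1.3)–(4.1.5) pp. 1163–1164; (4.2.18) p. 1168; Thm 4.3.4 p. 1169; §2.3 p. 1149;
  Alg 2.4.1 p. 1156; Thm 2.1.5 p. 1150; §7.1 pp. 1187–1188. [cite: BrumerEtAl2019]
-/

noncomputable section

namespace Literature.NumberTheory.FaltingsSerre

open Matrix Equiv Field IsDedekindDomain Polynomial
open Literature.NumberTheory.GaloisRepresentations Literature.NumberTheory.FaltingsSerre.GSp4F2
  Literature.NumberTheory.Automorphic.Paramodular Literature.NumberTheory.Automorphic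
  Literature.AlgebraicGeometry.Motives
open scoped NumberField

/-! ## Places of `ℚ`: every finite place lies over a rational prime -/

section Places

/-- Every nonzero prime `v` of `𝓞 ℚ` contains a rational prime `p` (the norm `N(v) ∈ v` is a product of
primes and `v` is prime). [folklore] -/
theorem exists_prime_natCast_mem (v : HeightOneSpectrum (𝓞 ℚ)) :
    ∃ p : ℕ, p.Prime ∧ ((p : ℕ) : 𝓞 ℚ) ∈ v.asIdeal := by
  classical
  haveI := v.isPrime
  have hn0 : Ideal.absNorm v.asIdeal ≠ 0 := fun h => v.ne_bot (Ideal.absNorm_eq_zero_iff.mp h)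
  have hmem : ((Ideal.absNorm v.asIdeal : ℕ) : 𝓞 ℚ) ∈ v.asIdeal := Ideal.absNorm_mem _
  rw [Nat.prod_primeFactors_pow_factorization hn0, Nat.cast_prod] at hmem
  obtain ⟨q, hq, hqv⟩ := Ideal.IsPrime.prod_mem_iff.1 hmem
  rw [Nat.cast_pow] at hqv
  exact ⟨q, Nat.prime_of_mem_primeFactors hq, v.isPrime.mem_of_pow_mem _ hqv⟩

/-- A prime `p` under a place `v ∉ placesOver (badPrimes N)` (`N ≠ 0`) is a good odd prime:
`p ≠ 2` and `p ∤ N`. [cite: BrumerEtAl2019, Thm 7.1.3 p. 1187] -/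
theorem ne_two_and_not_dvd_of_not_mem_placesOver {N : ℕ} [NeZero N]
    {v : HeightOneSpectrum (𝓞 ℚ)} (hv : v ∉ placesOver (badPrimes N)) {p : ℕ} (hp : p.Prime)
    (hpv : ((p : ℕ) : 𝓞 ℚ) ∈ v.asIdeal) : p ≠ 2 ∧ ¬ p ∣ N := by
  have hpb : p ∉ badPrimes N := fun h => hv ⟨p, h, hpv⟩
  rw [badPrimes, Finset.mem_insert, Nat.mem_primeFactors] at hpb
  exact ⟨fun h => hpb (Or.inl h), fun h => hpb (Or.inr ⟨hp, h, NeZero.ne N⟩)⟩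

end Places

/-! ## The trace of Frobenius from a surface-shaped Frobenius polynomial -/

section Trace

/-- `deg (1 − aT + bT² − qaT³ + q²T⁴) ≤ 4`. [folklore] -/
theorem natDegree_lPolynomialOfSurface_le (q : ℕ) (a b : ℤ) :
    (lPolynomialOfSurface q a b).natDegree ≤ 4 := by
  unfold lPolynomialOfSurface
  compute_degree

/-- The `T⁴`-coefficient of `lPolynomialOfSurface q a b` is `q²`. [folklore] -/
theorem coeff_lPolynomialOfSurface_four (q : ℕ) (a b : ℤ) :
    (lPolynomialOfSurface q a b).coeff 4 = (q : ℤ) ^ 2 := by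
  simp only [lPolynomialOfSurface, coeff_add, coeff_sub, coeff_one, coeff_C_mul, coeff_X_pow, coeff_X]
  norm_num

/-- The `T`-coefficient of `lPolynomialOfSurface q a b` is `−a`. [cite: BrumerEtAl2019, (4.1.5) p. 1164] -/
theorem coeff_lPolynomialOfSurface_one (q : ℕ) (a b : ℤ) :
    (lPolynomialOfSurface q a b).coeff 1 = -a := by
  simp only [lPolynomialOfSurface, coeff_add, coeff_sub, coeff_one, coeff_C_mul, coeff_X_pow, coeff_X]
  norm_num

/-- For `q ≠ 0`, `deg (1 − aT + bT² − qaT³ + q²T⁴) = 4`. [folklore] -/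
theorem natDegree_lPolynomialOfSurface {q : ℕ} (hq : q ≠ 0) (a b : ℤ) :
    (lPolynomialOfSurface q a b).natDegree = 4 :=
  le_antisymm (natDegree_lPolynomialOfSurface_le q a b)
    (le_natDegree_of_ne_zero (by
      rw [coeff_lPolynomialOfSurface_four]
      exact pow_ne_zero 2 (by exact_mod_cast hq)))

/-- For `q ≠ 0`, the `X³`-coefficient of `X⁴L(1/X) = X⁴ − aX³ + bX² − qaX + q²` is `−a`.
[cite: BrumerEtAl2019, (4.1.5) p. 1164] -/
theorem coeff_reverse_lPolynomialOfSurface_three {q : ℕ} (hq : q ≠ 0) (a b : ℤ) :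
    (lPolynomialOfSurface q a b).reverse.coeff 3 = -a := by
  rw [coeff_reverse, natDegree_lPolynomialOfSurface hq, revAt_le (by norm_num)]
  exact coeff_lPolynomialOfSurface_one q a b

/-- **`tr ρ(Frob_v) = a`** when the arithmetic Frobenii at `v` have characteristic polynomial
`X⁴ − aX³ + bX² − qaX + q²` (`= X⁴L(1/X)` for `L = 1 − aT + bT² − qaT³ + q²T⁴`, `q ≠ 0`): the trace is
minus the `X³`-coefficient of the characteristic polynomial (Mathlib `Matrix.trace_eq_neg_charpoly_coeff`).
With `L = L_p(A,T)` this is "`tr ρ_{A,ℓ}(Frob_p) = a_p`" [BPPTVY, (4.1.5) p. 1164]; with `L = Q_p(f,T)`,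
"`tr ρ_{f,ℓ}(Frob_p) = a_p(f)`" [(4.2.18) p. 1168, Thm 4.3.4 (iv) p. 1169]. [cite: BrumerEtAl2019, (4.1.5) p. 1164; (4.2.18) p. 1168] -/
theorem trace_eq_of_hasFrobCharpolyAt_lPolynomialOfSurface {ρ : FramedGaloisRep ℚ ℤ_[2] 4}
    {v : HeightOneSpectrum (𝓞 ℚ)} {q : ℕ} (hq : q ≠ 0) {a b : ℤ}
    (h : ρ.HasFrobCharpolyAt v ((lPolynomialOfSurface q a b).reverse.map (Int.castRingHom ℤ_[2]))) :
    ∀ 𝔓 ∈ v.primesAbove, ∀ σ : absoluteGaloisGroup ℚ, IsArithFrobAt (𝓞 ℚ) σ 𝔓 →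
      FramedRep.trace ρ σ = (a : ℤ_[2]) := by
  intro 𝔓 h𝔓 σ hσ
  have hc : ((ρ σ : GL (Fin 4) ℤ_[2]) : Matrix (Fin 4) (Fin 4) ℤ_[2]).charpoly =
      (lPolynomialOfSurface q a b).reverse.map (Int.castRingHom ℤ_[2]) := h 𝔓 h𝔓 σ hσ
  rw [FramedRep.trace, Matrix.trace_eq_neg_charpoly_coeff, hc, Polynomial.coeff_map, Fintype.card_fin,
    show (4 - 1 : ℕ) = 3 from rfl, coeff_reverse_lPolynomialOfSurface_three hq]
  simp

end Trace

/-! ## The core certificate -/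

section Core

variable {N : ℕ} {T : Finset ℕ} {ν : absoluteGaloisGroup ℚ → ℤ_[2]} {ρA ρf : FramedGaloisRep ℚ ℤ_[2] 4}

variable (N T ν ρA ρf) in
/-- **The core certificate of level `N` with check-prime set `T`** (`K = ℚ`, `ℓ = 2`, `G = GSp₄`,
`J = antiIdAlt4 ℤ_[2]`): the fields of `SurfaceConjCertificate N T ν ρA ρf` (`ConjCertificate.lean`)
that a certificate file must ATTEST, namely
* `similitude₁`, `similitude₂` — `ρ(σ)ᵀJρ(σ) = ν(σ)J` for both [BPPTVY, (4.1.3) p. 1163; Thm 4.3.4 (ii)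
  p. 1169; §7.1 p. 1187] (JSON block `similitude`);
* `residual_conj` — Step 1 up to frame: `ρ̄f = ι(π) ρ̄A ι(π)⁻¹` for some `π ∈ S₆` [§2.3 p. 1149;
  Alg 2.2.3 p. 1151] (block `residual`, via the residual-rigidity theorems);
* `absIrreducible` — `ρ̄A` absolutely irreducible [Lemma 5.1.7 p. 1173; Lemma 5.2.1 p. 1174]
  (block `residual`: image `S₅(b)`, `S₆` or `S₃ ≀ S₂`);
* `complete` — Steps 2–4: the Frobenii at the places over `T` detect every locally constant
  `𝔰𝔭`-valued obstructing deviation cocycle of `ρ̄A` unramified outside `2N` [Alg 2.4.1 p. 1156;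
  Remark 2.4.2; Thms 5.3.1, 5.3.3 p. 1176] (blocks `classfield`, `group_theory`, `obstructing`).
The remaining fields of `SurfaceConjCertificate` — `unramified₁`, `unramified₂`, `traces` — are
DERIVED (`CoreCertificate.toSurfaceConjCertificate`) from the Euler data of the instance template.
[cite: BrumerEtAl2019, Alg 2.4.1 p. 1156; Thm 2.1.5 p. 1150; §2.3 p. 1149] -/
structure CoreCertificate : Prop where
  /-- `ρA(σ)ᵀ J ρA(σ) = ν(σ) J`, `J = antiIdAlt4 ℤ_[2]`. -/
  similitude₁ : ∀ σ, IsSimilitude (antiIdAlt4 ℤ_[2]) (ν σ)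
    ((ρA σ : GL (Fin 4) ℤ_[2]) : Matrix (Fin 4) (Fin 4) ℤ_[2])
  /-- `ρf(σ)ᵀ J ρf(σ) = ν(σ) J` (same `ν`). -/
  similitude₂ : ∀ σ, IsSimilitude (antiIdAlt4 ℤ_[2]) (ν σ)
    ((ρf σ : GL (Fin 4) ℤ_[2]) : Matrix (Fin 4) (Fin 4) ℤ_[2])
  /-- Step 1 up to frame: `ρ̄f = ι(π) ρ̄A ι(π)⁻¹` for some `π ∈ S₆`. -/
  residual_conj : ∃ π : Perm (Fin 6), ∀ σ,
    residual ρf.toMonoidHom σ = iotaGL π * residual ρA.toMonoidHom σ * (iotaGL π)⁻¹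
  /-- `ρ̄A` is absolutely irreducible. -/
  absIrreducible : IsAbsIrreducible (residual ρA.toMonoidHom)
  /-- Steps 2–4 for `ρ̄A` with `S` = places over `2N`, `P` = places over `T`. -/
  complete : ∀ μ : absoluteGaloisGroup ℚ → Matrix (Fin 4) (Fin 4) (ZMod 2), IsLocallyConstant μ →
    (∀ σ ∈ inertiaOutside ℚ (placesOver (badPrimes N)), μ σ = 0) →
    ValuedIn (spLie ((antiIdAlt4 ℤ_[2]).map (PadicInt.toZMod (p := 2)))) μ →
    IsDeviationCocycle (residual ρA.toMonoidHom) μ → IsObstructing (residual ρA.toMonoidHom) μ →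
    ∃ σ ∈ frobeniusAt ℚ (placesOver T), IsObstructingElt (residual ρA.toMonoidHom) μ σ

/-- The forgetful direction: a surface certificate up to frame contains a core certificate. [cite: BrumerEtAl2019, Alg 2.4.1 p. 1156] -/
theorem CoreCertificate.ofSurfaceConjCertificate (C : SurfaceConjCertificate N T ν ρA ρf) :
    CoreCertificate N T ν ρA ρf where
  similitude₁ := ConjCertificate.similitude₁ C
  similitude₂ := ConjCertificate.similitude₂ C
  residual_conj := ConjCertificate.residual_conj C
  absIrreducible := ConjCertificate.absIrreducible C
  complete := ConjCertificate.complete C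

variable {A : AbelianVariety ℚ} {b : Module.Basis (Fin 4) ℚ_[2] (A.rationalTateModule 2)}

/-- **Curve side: `ρA` is unramified outside `2N`** — DERIVED, not attested.  If `ρA` frames
`ρ_{A,2}` (`hframe`, (4.1.3)) and `A` has good Euler factors of surface shape at every prime `p ∤ N`
(`hA`, (4.1.4)–(4.1.5): `HasGoodEulerFactorAt` records that `ρ_{A,ℓ}` is unramified at `p ≠ ℓ`), then
`ρA` is unramified at every place not over `badPrimes N = {2} ∪ {p ∣ N}` [BPPTVY, (4.1.3) p. 1163:
"`ρ_{A,ℓ} : Gal_{ℚ,S} → GSp₄(ℤ_ℓ)` … unramified outside `ℓN`"]: the place lies over some prime `p`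
(`exists_prime_natCast_mem`), necessarily good and odd, and `integralForm_of_hasGoodEulerFactorAt`
applies. [cite: BrumerEtAl2019, (4.1.3)–(4.1.5) pp. 1163–1164] -/
theorem isUnramifiedAt_of_hasGoodEulerFactors [NeZero N]
    (hframe : A.IsFrameOfTateRep 2 b (rationalize ρA)) (aA bA : ℕ → ℤ)
    (hA : ∀ p : ℕ, p.Prime → ¬ p ∣ N →
      A.HasGoodEulerFactorAt p ((lPolynomialOfSurface p (aA p) (bA p)).map (Int.castRingHom ℚ))) :
    ∀ v ∉ placesOver (badPrimes N), ρA.IsUnramifiedAt v := by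
  intro v hv
  obtain ⟨p, hp, hpv⟩ := exists_prime_natCast_mem v
  obtain ⟨hp2, hpN⟩ := ne_two_and_not_dvd_of_not_mem_placesOver hv hp hpv
  exact (integralForm_of_hasGoodEulerFactorAt (hA p hp hpN) (Ne.symm hp2) hframe hpv).1

/-- **Core certificate + Euler data ⟹ surface certificate up to frame.**  Binders: the core
certificate `hC`; the curve side `hframe`, `hA` [(4.1.3)–(4.1.5)]; the form side `hρf_unr`
[Thm 4.3.4 (iii) p. 1169: "`ρ_{f,ℓ}` is unramified outside `ℓN`"] and `hρf` [Thm 4.3.4 (iv):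
"`det(1 − ρ_{f,ℓ}(Frob_p)T) = Q_p(f,T)` for all `p ∤ ℓN`", with `Q_p(f,T)` of shape (4.2.18)] — both
properties of the CITED `ρ_{f,2}` (Arthur-dependent INPUT); `hT`: every check prime is a good odd
prime (`p` prime, `p ∤ N`, `p ≠ 2` — Step 4 searches among such); and the TRACE TABLE
`h5 : ∀ p ∈ T, aA p = af p` = Step 5 [Alg 2.4.1 p. 1156; §7.1 p. 1188: "we will show that
`tr ρ_A(Frob_p) = tr ρ_f(Frob_p)` for all `p ≤ 43`.  The former traces can be done by counting
points, the latter … using the method in Example 6.6.1, and we check that they are equal"].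
Conclusion: `SurfaceConjCertificate N T ν ρA ρf` — `unramified₁` by
`isUnramifiedAt_of_hasGoodEulerFactors`, `unramified₂ := hρf_unr`, `traces` by
`trace_eq_of_hasFrobCharpolyAt_lPolynomialOfSurface` on both sides and `h5`.
[cite: BrumerEtAl2019, Alg 2.4.1 p. 1156; Thm 4.3.4 p. 1169; (4.1.5) p. 1164; §7.1 p. 1188] -/
theorem CoreCertificate.toSurfaceConjCertificate [NeZero N] (hC : CoreCertificate N T ν ρA ρf)
    (hframe : A.IsFrameOfTateRep 2 b (rationalize ρA)) (aA bA af bf : ℕ → ℤ)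
    (hA : ∀ p : ℕ, p.Prime → ¬ p ∣ N →
      A.HasGoodEulerFactorAt p ((lPolynomialOfSurface p (aA p) (bA p)).map (Int.castRingHom ℚ)))
    (hρf_unr : ∀ v ∉ placesOver (badPrimes N), ρf.IsUnramifiedAt v)
    (hρf : ∀ p : ℕ, p.Prime → ¬ p ∣ N → p ≠ 2 →
      ∀ v : HeightOneSpectrum (𝓞 ℚ), ((p : ℕ) : 𝓞 ℚ) ∈ v.asIdeal →
        ρf.HasFrobCharpolyAt v
          ((lPolynomialOfSurface p (af p) (bf p)).reverse.map (Int.castRingHom ℤ_[2])))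
    (hT : ∀ p ∈ T, p.Prime ∧ ¬ p ∣ N ∧ p ≠ 2) (h5 : ∀ p ∈ T, aA p = af p) :
    SurfaceConjCertificate N T ν ρA ρf where
  similitude₁ := hC.similitude₁
  similitude₂ := hC.similitude₂
  residual_conj := hC.residual_conj
  absIrreducible := hC.absIrreducible
  unramified₁ := isUnramifiedAt_of_hasGoodEulerFactors hframe aA bA hA
  unramified₂ := hρf_unr
  complete := hC.complete
  traces := fun σ hσ => by
    obtain ⟨v, ⟨p, hpT, hpv⟩, 𝔓, h𝔓, hσ𝔓⟩ := hσ
    obtain ⟨hp, hpN, hp2⟩ := hT p hpT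
    rw [trace_eq_of_hasFrobCharpolyAt_lPolynomialOfSurface hp.ne_zero
        (integralForm_of_hasGoodEulerFactorAt (hA p hp hpN) (Ne.symm hp2) hframe hpv).2 𝔓 h𝔓 σ hσ𝔓,
      trace_eq_of_hasFrobCharpolyAt_lPolynomialOfSurface hp.ne_zero (hρf p hp hpN hp2 v hpv) 𝔓 h𝔓 σ
        hσ𝔓, h5 p hpT]

/-- **`A` is paramodular of level `N` away from `N`, from a CORE certificate** — the instance template
in core form.  Binders as in `paramodular_of_surfaceConjCertificate_holds` (`ConjCertificate.lean`)
except that the certificate hypothesis is the five-field `CoreCertificate N T ν ρA ρf` and three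
hypotheses are added in exchange for the three dropped certificate fields: `hρf_unr` [Thm 4.3.4 (iii)
p. 1169], `hT` (the check primes are good odd primes) and the Step-5 trace table
`h5 : ∀ p ∈ T, aA p = af p` [Alg 2.4.1 p. 1156; §7.1 p. 1188].  Conclusion `IsParamodularAwayFrom A N f`:
`L_p(A,T) = Q_p(f,T)` for every prime `p ∤ N` [Thm 7.1.3 p. 1187]; the criterion [Thm 2.1.5] is
discharged by the tree's `traceEq_of_faltingsSerre_symplectic_holds`.
[cite: BrumerEtAl2019, Thm 7.1.3 p. 1187; Thm 2.1.5 p. 1150; Thm 4.3.4 p. 1169; Alg 2.4.1 p. 1156] -/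
theorem paramodular_of_coreCertificate [NeZero N] {f : Matrix (Fin 2) (Fin 2) ℂ → ℂ}
    (hC : CoreCertificate N T ν ρA ρf)
    (hframe : A.IsFrameOfTateRep 2 b (rationalize ρA)) (aA bA af bf : ℕ → ℤ)
    (hA : ∀ p : ℕ, p.Prime → ¬ p ∣ N →
      A.HasGoodEulerFactorAt p ((lPolynomialOfSurface p (aA p) (bA p)).map (Int.castRingHom ℚ)))
    (hρf_unr : ∀ v ∉ placesOver (badPrimes N), ρf.IsUnramifiedAt v)
    (hρf : ∀ p : ℕ, p.Prime → ¬ p ∣ N → p ≠ 2 →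
      ∀ v : HeightOneSpectrum (𝓞 ℚ), ((p : ℕ) : 𝓞 ℚ) ∈ v.asIdeal →
        ρf.HasFrobCharpolyAt v
          ((lPolynomialOfSurface p (af p) (bf p)).reverse.map (Int.castRingHom ℤ_[2])))
    (hT : ∀ p ∈ T, p.Prime ∧ ¬ p ∣ N ∧ p ≠ 2) (h5 : ∀ p ∈ T, aA p = af p)
    (hcusp : IsParamodularCuspForm N 2 f) (hne : ∃ Z ∈ siegelUpperHalfSpace 2, f Z ≠ 0)
    (hfe : ∀ p : ℕ, p.Prime → ¬ p ∣ N →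
      HasSpinorEulerFactorAt 2 p f ((lPolynomialOfSurface p (af p) (bf p)).map (Int.castRingHom ℂ)))
    (h2 : ¬ 2 ∣ N → aA 2 = af 2 ∧ bA 2 = bf 2) :
    IsParamodularAwayFrom A N f :=
  paramodular_of_surfaceConjCertificate_holds
    (hC.toSurfaceConjCertificate hframe aA bA af bf hA hρf_unr hρf hT h5) hframe aA bA af bf hA hρf
    hcusp hne hfe h2

end Core

/-! ## Worked instance `N = 349` in core form -/

namespace Paramodular349

/-- The eleven check primes `T = {3, 5, 7, 11, 13, 17, 19, 23, 29, 31, 43}` of the frozen `N = 349`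
certificate (`Paramodular349.lean`, sha256 `0b9d070d407f6211…`) are good odd primes: prime, `∤ 349`,
`≠ 2`. [cite: BrumerEtAl2019, Alg 2.4.1 Step 4 p. 1156] -/
theorem checkPrimes349_good : ∀ p ∈ checkPrimes349, p.Prime ∧ ¬ p ∣ 349 ∧ p ≠ 2 := by
  decide

/-- **The `N = 349` core certificate, as a hypothesis**: `CoreCertificate 349 checkPrimes349 ν ρA ρf` —
the blocks `similitude`, `residual` (image `S₅(b)`, Step 1 by the transvection route), `classfield` +
`group_theory` + `obstructing` (`4095` quadratic extensions; check primes `checkPrimes349`) of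
`certs/349/certificate.canonical.json` (sha256 `0b9d070d407f6211ba094695ef509e92c9ce0838fa2e62a6110db86c60cabd92`),
WITHOUT its `trace_check` block (now the hypothesis `h5` of `paramodular_349_of_coreCertificate`) and
without unramifiedness claims (derived / cited). [cite: BrumerEtAl2019, Alg 2.4.1 p. 1156; Thm 2.1.5 p. 1150] -/
def CoreCertificate349 (ν : Field.absoluteGaloisGroup ℚ → ℤ_[2]) (ρA ρf : FramedGaloisRep ℚ ℤ_[2] 4) :
    Prop :=
  CoreCertificate 349 checkPrimes349 ν ρA ρf

/-- **`A₃₄₉` is paramodular of level `349` away from `349`, from the core certificate and the trace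
table.**  `paramodular_of_coreCertificate` with `N = 349`, `T = checkPrimes349` (`hT` discharged by
`checkPrimes349_good`); `h5 : ∀ p ∈ T, aA p = af p` is the `trace_check` block (`a_p(A₃₄₉) = a_p(f₃₄₉)`
for the eleven check primes, each side by two implementations in the cell's certificate); `h2` the hand
check at `p = 2`. [cite: BrumerEtAl2019, Thm 2.1.5 p. 1150; Thm 4.3.4 p. 1169; Alg 2.4.1 p. 1156] -/
theorem paramodular_349_of_coreCertificate
    {A : AbelianVariety ℚ} {f : Matrix (Fin 2) (Fin 2) ℂ → ℂ}
    {ρA ρf : FramedGaloisRep ℚ ℤ_[2] 4} {ν : Field.absoluteGaloisGroup ℚ → ℤ_[2]}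
    {b : Module.Basis (Fin 4) ℚ_[2] (A.rationalTateModule 2)}
    (hC : CoreCertificate349 ν ρA ρf)
    (hframe : A.IsFrameOfTateRep 2 b (rationalize ρA))
    (aA bA af bf : ℕ → ℤ)
    (hA : ∀ p : ℕ, p.Prime → ¬ p ∣ 349 →
      A.HasGoodEulerFactorAt p ((lPolynomialOfSurface p (aA p) (bA p)).map (Int.castRingHom ℚ)))
    (hρf_unr : ∀ v ∉ placesOver (badPrimes 349), ρf.IsUnramifiedAt v)
    (hρf : ∀ p : ℕ, p.Prime → ¬ p ∣ 349 → p ≠ 2 →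
      ∀ v : HeightOneSpectrum (𝓞 ℚ), ((p : ℕ) : 𝓞 ℚ) ∈ v.asIdeal →
        ρf.HasFrobCharpolyAt v
          ((lPolynomialOfSurface p (af p) (bf p)).reverse.map (Int.castRingHom ℤ_[2])))
    (h5 : ∀ p ∈ checkPrimes349, aA p = af p)
    (hcusp : IsParamodularCuspForm 349 2 f) (hne : ∃ Z ∈ siegelUpperHalfSpace 2, f Z ≠ 0)
    (hfe : ∀ p : ℕ, p.Prime → ¬ p ∣ 349 →
      HasSpinorEulerFactorAt 2 p f ((lPolynomialOfSurface p (af p) (bf p)).map (Int.castRingHom ℂ)))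
    (h2 : aA 2 = af 2 ∧ bA 2 = bf 2) :
    IsParamodularAwayFrom A 349 f :=
  paramodular_of_coreCertificate hC hframe aA bA af bf hA hρf_unr hρf checkPrimes349_good h5 hcusp hne
    hfe (fun _ => h2)

end Paramodular349

end Literature.NumberTheory.FaltingsSerre

end
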